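import Summits.QuantumFields.YangMills.Theorems.AlphaInputsT3ACv3Data7Closed
import Summits.QuantumFields.YangMills.Theorems.AlphaInputsT3ACv3InClassSelXsOfNestedRegularR7
import Summits.QuantumFields.YangMills.Theorems.AlphaInputsT3ACv3FrozenSelection
import HarnessLib

/-!
# `AlphaInputsT3ACv3Data7Selectors` — B1 EDGES-A v2, FILE 1 rows (n3)+(n4): THE TWO MEASURABLE SELECTIONS OF B1's «ON THE (7)-SET» BRANCH, BY NAME —
# (n3) a measurable FROZEN-DATA selector `W ↦ 𝓥*(W)` INTO the closed (7)-set `𝒟₇(k,h)` with prescribed top `𝓥*(W) k = W`, and (n4) a measurable MINIMISER of the Wilson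
# action over print's regional regular fibre (8) (read with `≤`, on the local small-loop core) at the data `𝓥*(W)` — the assembly of ✓ `…Data7Closed` (C1)–(C3) with the
# tree's selection theorems; what is left to NODE O is exactly: non-emptiness, «print's minimiser IS that argmin», and the display's nested (2)

Cell `ym3-torus` (HUMAN RULING D-0037; YM ladder rung R3 = finite-torus SU(2) YM₃, NOT the Clay problem), width seat `ym-ust-19936-w2` (gen 6) on
stmt-QuantumFields-19936 `HistoryTailL`; LEAD ★w1-19936 g4 RULING L-R6∕L-R7 (B1 EDGES-A v2: display ✓ `AlphaInputsT3AC.NestedRegularSelT3R7` over ✓ `AlphaInputsT3AC.data7Set`,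
FILE 1 = the closedness rows).  `--supports stmt-QuantumFields-19936 --as helper`; def-free; count-neutral.

WHAT (T³, `SU(2)`, `ℰp`; `h : Hist (F.P K) k`, `Ω_j(h) = Carriers.Omega …`, `Λ_j(h) = lam42 Ω(h) k j`).
* §1 `RegionalVP.continuous_ofDataE` — the normal form of multi-level data `ofDataE k Λ` (✓ `…RegionalThm1CarrierData`) is CONTINUOUS on `(j : ℕ) → GaugeField P j G` (each
  component an evaluation or the constant `1`).
* §2 (n3) ★ `AlphaInputsT3AC.exists_data7Selector (k) (h) (ε₁)`: a measurable `sel : SU(2)^{bonds_k} → ((j : ℕ) → SU(2)^{bonds_j})` with `sel W ∈ data7Set … k h ε₁` and `sel W k = W`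
  whenever SOME `𝓥 ∈ 𝒟₇(k,h)` has top `W`, and `sel W = 1` otherwise — ✓ `FrozenSelection.exists_measurable_selector_closedClass` run DIRECTLY on the countable product
  `(j : ℕ) → GaugeField (F.P K) j SU(2)` (compact, Polish, Borel — no `Fin (k+1)` bridge), closed class ✓ `AlphaInputsT3AC.isClosed_data7`, `g := eval k`, `R :=` the diagonal
  (FILE 2's FULL top equality `𝓥 k = W`).
* §3 (n4) ★★ `AlphaInputsT3AC.exists_measurable_argmin_constraintOn (hk) (h) (hE : DepClosed₂ E) (hread) (hC : IsClosed C) (hCcore : C ⊆ core) (hsel : Measurable sel)`: for ANY closed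
  `W`-INDEPENDENT class `C` inside the local small-loop core `NestedSmallOn ℰp (δ∕2) E k` (e.g. core ∩ {(2) with ≤}: ✓ `isClosed_nestedSmallOn₂` ∩ ✓ `isClosed_regOnT3Le`, whose cut by
  (3) is the set of ✓ `AlphaInputsT3AC.isClosed_coneFibreRegLe`) and ANY measurable data map `sel`, a measurable `f : SU(2)^{bonds_k} → SU(2)^{bonds_0}` with `f W` a MINIMISER of
  `wilsonAction4` over `A(W) := C ∩ {(3) ConstraintOn (blockAvg ℰp) k Λ(h) (sel W)}` whenever a minimiser exists, AND a minimiser EXISTS as soon as `A(W) ≠ ∅` —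
  ✓ `exists_measurable_argmin_closedClass` with `g := datumE …` continuous ON `C` (✓ `continuousOn_datumE_T3`), `π := ofDataE k Λ ∘ sel` measurable (§1), `R :=` the diagonal of
  the data space, and «`(datumE U, ofDataE (sel W)) ∈ R ↔ (3)`» = ✓ `RegionalVP.datumE_eq_ofDataE_iff`.
SO, BY NAME: B1's «on the (7)-set» branch = `UkH k h W := f W` with `𝓥′ := sel W` (§2∕§3) — measurable, in print's fibre (8)≤ at radius `e`, pinned by (3) to `sel W` (top `W`,
`Λ₀ = Ω₁ᶜ` included); NODE O ∕ EDGES-B owe: `A(W) ≠ ∅` on the (7)-set ([Balaban1985Variational] Thm 1 (8), existence), «print's minimiser is such an argmin» (idem, minimality in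
(6) ⊇ (8)), and the display's nested (2) at the record radii (then ✓ `mem_nestedSmallOn_constraintCone_of_plaqSmallOn_Omega` certifies the core conjunct of `A(W)`).
HONEST FRAMING.  Measurable-selection bookkeeping ([AliprantisBorder2006] Thm 18.19) over the tree's closedness facts; no estimate of [Balaban1985UV3]∕[Balaban1985Variational] is
asserted; B1, NODE O, the stub `AlphaInputsT3ACv4RecChi`, the crux `HistoryTailL` are NOT claimed; the argmin of §3 is NOT claimed to be print's (42)-minimiser.  YM₃ on the
three-torus is rung R3 of the programme, NOT the Clay problem: nothing here bears on d = 4, infinite volume, or a mass gap.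

References: C. D. Aliprantis, K. C. Border, Infinite Dimensional Analysis, 3rd ed. (2006) [AliprantisBorder2006] (Thm 18.19 p.605); T. Bałaban, Commun. Math. Phys. 102 (1985)
277–309 [Balaban1985Variational] ((2)–(3), (7) p.278, Thm 1 (8) p.279); Commun. Math. Phys. 102 (1985) 255–275 [Balaban1985UV3] ((40)–(42) p.266).
-/

set_option autoImplicit false

noncomputable section

/-! ## §1 The normal form of multi-level data is continuous -/

namespace Summit.QuantumFields.YangMills.Theorems.RegionalVP

open Set Topology
open Literature.MathematicalPhysics.QuantumFieldTheory.Balaban1983to89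

variable {P : Params} {G : Type*} [GaugeGroup G] [TopologicalSpace G]

/-- **`ofDataE k Λ` IS CONTINUOUS** on `(j : ℕ) → GaugeField P j G` (product topology): the component at `(j, b)` is the evaluation `𝓥 ↦ 𝓥 j b` on the constrained bonds of the
levels `≤ k` and the constant `1` elsewhere — the branch condition does not depend on `𝓥`. [cite: Balaban1985Variational, (3) p.278] -/
theorem continuous_ofDataE (k : ℕ) (Λ : ℕ → Set (Site P 0)) :
    Continuous fun 𝓥 : (j : ℕ) → GaugeField P j G => ofDataE k Λ 𝓥 := by
  refine continuous_pi fun j => continuous_pi fun b => ?_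
  by_cases h : j ≤ k ∧ b ∈ bondsOn j (Λ j)
  · have heq : (fun 𝓥 : (j : ℕ) → GaugeField P j G => ofDataE k Λ 𝓥 j b) = fun 𝓥 => 𝓥 j b :=
      funext fun 𝓥 => ofDataE_of_mem h.1 h.2
    rw [heq]
    exact (continuous_apply b).comp (continuous_apply j)
  · have heq : (fun 𝓥 : (j : ℕ) → GaugeField P j G => ofDataE k Λ 𝓥 j b) = fun _ => (1 : G) :=
      funext fun 𝓥 => ofDataE_of_not h
    rw [heq]
    exact continuous_const

end Summit.QuantumFields.YangMills.Theorems.RegionalVP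

/-! ## §2 (n3) The measurable frozen-data selector into the (7)-set -/

namespace Summit.QuantumFields.YangMills.Theorems

open MeasureTheory Set Topology
open scoped Matrix.Norms.L2Operator
open Literature.MathematicalPhysics.QuantumFieldTheory.Balaban1983to89
open Literature.MathematicalPhysics.QuantumFieldTheory.Balaban1983to89.T3ContinuumYM3Torus
open Literature.MathematicalPhysics.QuantumFieldTheory.Balaban1983to89.T3UnitLawDensityEML (ℰp)
open Literature.MathematicalPhysics.QuantumFieldTheory.Balaban1983to89.B10Eq38TorusDomains (toFine)
open Literature.MathematicalPhysics.QuantumFieldTheory.Balaban1983to89.B10Eq42TorusConstraint (lam42)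
open Literature.MathematicalPhysics.QuantumFieldTheory.Balaban1983to89.B10Eq27TorusAxialLog (toUField unitsField)
open Literature.MathematicalPhysics.QuantumFieldTheory.Balaban1983to89.B10Eq68TorusRegularity (Touches BTouches covDivT)
open Literature.MathematicalPhysics.QuantumFieldTheory.Balaban1985CMP102.Setting
open Summit.QuantumFields.Balaban3D.Carriers
open Summit.QuantumFields.Balaban3D.Proofs.Primitives (AlphaConsts)
open Summit.QuantumFields.BalabanUV.T4Continuum.SubstrateBlockAvgContinuity (smallContinuous_expMeanLogSU)
open Summit.QuantumFields.YangMills.Theorems.BalabanUVNodesN08AlphaGroupTopology (polishSpace_rho)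
open Summit.QuantumFields.YangMills.Theorems.LocalSmallLoop (NestedSmallOn DepClosed₂ isClosed_nestedSmallOn₂)
open Summit.QuantumFields.YangMills.Theorems.FrozenSelection (exists_measurable_selector_closedClass)
open Summit.QuantumFields.YangMills.Theorems.RegionalVP

section T3

variable {F : T3Family} {𝔠 : AlphaConsts F.L (suGroupModel 2).N} {γ : ℝ} {hγ : 0 < γ} {hγ1 : γ ≤ (min 𝔠.gamma0 1) ^ 2} {K : ℕ}

/-- ★ **(n3) A MEASURABLE FROZEN-DATA SELECTION INTO THE (7)-SET WITH PRESCRIBED TOP DATUM**: for the history `h` of level `k` and any level radii `ε₁` there is a measurable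
`sel : SU(2)^{bonds_k} → ((j : ℕ) → SU(2)^{bonds_j})` with `sel W ∈ 𝒟₇(k,h)` and `sel W k = W` whenever some `𝓥 ∈ 𝒟₇(k,h)` has top component `W` (FILE 2's FULL top equality), and
`sel W = 1` otherwise — ✓ `FrozenSelection.exists_measurable_selector_closedClass` on the countable product `(j : ℕ) → GaugeField (F.P K) j SU(2)` (compact Polish Borel), closed
class ✓ `AlphaInputsT3AC.isClosed_data7`, `g := eval k`, `R :=` the diagonal.  B1's `𝓥*`. [cite: AliprantisBorder2006, Thm 18.19 p.605; Balaban1985Variational, (3) + (7) p.278] -/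
theorem AlphaInputsT3AC.exists_data7Selector (k : ℕ) (h : Hist (F.P K) k) (ε₁ : ℕ → ℝ) :
    ∃ sel : GaugeField (F.P K) k (Matrix.specialUnitaryGroup (Fin 2) ℂ) → ((j : ℕ) → GaugeField (F.P K) j (Matrix.specialUnitaryGroup (Fin 2) ℂ)),
      Measurable sel ∧
      (∀ W, (∃ 𝓥 ∈ AlphaInputsT3AC.data7Set F 𝔠 γ hγ hγ1 K k h ε₁, 𝓥 k = W) →
        sel W ∈ AlphaInputsT3AC.data7Set F 𝔠 γ hγ hγ1 K k h ε₁ ∧ sel W k = W) ∧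
      (∀ W, ¬ (∃ 𝓥 ∈ AlphaInputsT3AC.data7Set F 𝔠 γ hγ hγ1 K k h ε₁, 𝓥 k = W) → sel W = fun _ _ => 1) := by
  haveI : PolishSpace (Matrix.specialUnitaryGroup (Fin 2) ℂ) := polishSpace_rho (suGroupModel 2)
  haveI : ∀ j : ℕ, CompactSpace (GaugeField (F.P K) j (Matrix.specialUnitaryGroup (Fin 2) ℂ)) :=
    fun j => inferInstanceAs (CompactSpace (PBond (F.P K) j → Matrix.specialUnitaryGroup (Fin 2) ℂ))
  haveI : ∀ j : ℕ, PolishSpace (GaugeField (F.P K) j (Matrix.specialUnitaryGroup (Fin 2) ℂ)) :=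
    fun j => inferInstanceAs (PolishSpace (PBond (F.P K) j → Matrix.specialUnitaryGroup (Fin 2) ℂ))
  haveI : ∀ j : ℕ, SecondCountableTopology (GaugeField (F.P K) j (Matrix.specialUnitaryGroup (Fin 2) ℂ)) :=
    fun j => inferInstanceAs (SecondCountableTopology (PBond (F.P K) j → Matrix.specialUnitaryGroup (Fin 2) ℂ))
  haveI : ∀ j : ℕ, BorelSpace (GaugeField (F.P K) j (Matrix.specialUnitaryGroup (Fin 2) ℂ)) :=
    fun j => inferInstanceAs (BorelSpace (PBond (F.P K) j → Matrix.specialUnitaryGroup (Fin 2) ℂ))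
  haveI : CompactSpace ((j : ℕ) → GaugeField (F.P K) j (Matrix.specialUnitaryGroup (Fin 2) ℂ)) := inferInstance
  haveI : PolishSpace ((j : ℕ) → GaugeField (F.P K) j (Matrix.specialUnitaryGroup (Fin 2) ℂ)) := inferInstance
  haveI : BorelSpace ((j : ℕ) → GaugeField (F.P K) j (Matrix.specialUnitaryGroup (Fin 2) ℂ)) := inferInstance
  have hC : IsClosed (AlphaInputsT3AC.data7Set F 𝔠 γ hγ hγ1 K k h ε₁) :=
    AlphaInputsT3AC.isClosed_data7 (𝔠 := 𝔠) (hγ := hγ) (hγ1 := hγ1) k h ε₁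
  have hg : ContinuousOn (fun 𝓥 : (j : ℕ) → GaugeField (F.P K) j (Matrix.specialUnitaryGroup (Fin 2) ℂ) => 𝓥 k)
      (AlphaInputsT3AC.data7Set F 𝔠 γ hγ hγ1 K k h ε₁) := (continuous_apply k).continuousOn
  have hR : IsClosed {p : GaugeField (F.P K) k (Matrix.specialUnitaryGroup (Fin 2) ℂ) × GaugeField (F.P K) k (Matrix.specialUnitaryGroup (Fin 2) ℂ) | p.1 = p.2} :=
    isClosed_eq continuous_fst continuous_snd
  obtain ⟨f, hfm, hfin, hfout⟩ := exists_measurable_selector_closedClass (X := GaugeField (F.P K) k (Matrix.specialUnitaryGroup (Fin 2) ℂ))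
    (π := id) measurable_id hC hg hR (fun _ _ => 1)
  refine ⟨f, hfm, fun W hW => ?_, fun W hW => hfout W ?_⟩
  · obtain ⟨𝓥, h𝓥, h𝓥W⟩ := hW
    exact hfin W ⟨𝓥, h𝓥, h𝓥W⟩
  · rintro ⟨𝓥, h𝓥, h𝓥W⟩
    exact hW ⟨𝓥, h𝓥, h𝓥W⟩

/-! ## §3 (n4) The measurable minimiser over a closed core class cut by the constraint (3) at measurably selected data -/

/-- ★★ **(n4) A MEASURABLE MINIMISER OVER PRINT'S REGIONAL FIBRE AT MEASURABLY SELECTED DATA**: for `k ≤ K`, a history `h`, ANY closed class `C` of fine configurations inside the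
local small-loop core `NestedSmallOn ℰp (δ∕2) E k` of an exactly dependency-closed family `E ⊇` the read bonds of (3) (e.g. `C :=` core ∩ {(2) with ≤ over the `Ω_j(h)`} at the
constraint's cone, closed by ✓ `isClosed_nestedSmallOn₂` ∩ ✓ `AlphaInputsT3AC.isClosed_regOnT3Le` — then `C ∩ {(3)}` is the set of ✓ `AlphaInputsT3AC.isClosed_coneFibreRegLe`), and ANY
measurable data map `sel : SU(2)^{bonds_k} → ((j : ℕ) → SU(2)^{bonds_j})` (e.g. §2's `𝓥*`), there is a measurable `f : SU(2)^{bonds_k} → SU(2)^{bonds_0}` such that with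
`A(W) := C ∩ {U | ConstraintOn (blockAvg ℰp) k Λ(h) (sel W) U}`: (i) `f W` MINIMISES `wilsonAction4` over `A(W)` whenever a minimiser exists, `f W = 1` otherwise; (ii) a minimiser EXISTS
as soon as `A(W) ≠ ∅`.  ✓ `exists_measurable_argmin_closedClass` with the `W`-independent closed class `C`, `g := datumE (blockAvg ℰp) k Λ(h)` (continuous ON `C` by
✓ `AlphaInputsT3AC.continuousOn_datumE_T3`), `π := ofDataE k Λ(h) ∘ sel` (measurable, §1), `R :=` the diagonal of the data space, and «`(datumE U, ofDataE (sel W)) ∈ R ↔ (3)`» =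
✓ `RegionalVP.datumE_eq_ofDataE_iff`.  B1's `UkH k h W` on the (7)-set; NOT claimed to be print's (42)-minimiser.
[cite: AliprantisBorder2006, Thm 18.19 p.605; Balaban1985Variational, (2)–(3), (6) p.278, (8) p.279] -/
theorem AlphaInputsT3AC.exists_measurable_argmin_constraintOn {k : ℕ} (hk : k ≤ K) (h : Hist (F.P K) k)
    {E : (i : ℕ) → Set (PBond (F.P K) i)} (hE : DepClosed₂ E)
    (hread : ∀ j, j ≤ k → bondsOn j (lam42 (Omega 𝔠.lane.carrier.M₁
      (rcolOf (T3Scales F γ hγ (hγ1.trans (sq_min_one_le _ 𝔠.gamma0_pos)) K) 𝔠.lane.carrier) k h) k j) ⊆ E j)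
    {C : Set (GaugeField (F.P K) 0 (Matrix.specialUnitaryGroup (Fin 2) ℂ))} (hC : IsClosed C) (hCcore : C ⊆ NestedSmallOn ℰp (ℰp.δ / 2) E k)
    {sel : GaugeField (F.P K) k (Matrix.specialUnitaryGroup (Fin 2) ℂ) → ((j : ℕ) → GaugeField (F.P K) j (Matrix.specialUnitaryGroup (Fin 2) ℂ))}
    (hsel : Measurable sel) :
    ∃ f : GaugeField (F.P K) k (Matrix.specialUnitaryGroup (Fin 2) ℂ) → GaugeField (F.P K) 0 (Matrix.specialUnitaryGroup (Fin 2) ℂ),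
      Measurable f ∧
      (∀ W,
        (∃ U ∈ C ∩ {U : GaugeField (F.P K) 0 (Matrix.specialUnitaryGroup (Fin 2) ℂ) |
              ConstraintOn (fun i => BlockAveraging.blockAvg (P := F.P K) (j := i) ℰp) k
                (lam42 (Omega 𝔠.lane.carrier.M₁ (rcolOf (T3Scales F γ hγ (hγ1.trans (sq_min_one_le _ 𝔠.gamma0_pos)) K) 𝔠.lane.carrier) k h) k) (sel W) U},
          IsMinOn (fun U : GaugeField (F.P K) 0 (Matrix.specialUnitaryGroup (Fin 2) ℂ) => wilsonAction4 U)
            (C ∩ {U : GaugeField (F.P K) 0 (Matrix.specialUnitaryGroup (Fin 2) ℂ) |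
              ConstraintOn (fun i => BlockAveraging.blockAvg (P := F.P K) (j := i) ℰp) k
                (lam42 (Omega 𝔠.lane.carrier.M₁ (rcolOf (T3Scales F γ hγ (hγ1.trans (sq_min_one_le _ 𝔠.gamma0_pos)) K) 𝔠.lane.carrier) k h) k) (sel W) U}) U) →
        f W ∈ C ∩ {U : GaugeField (F.P K) 0 (Matrix.specialUnitaryGroup (Fin 2) ℂ) |
              ConstraintOn (fun i => BlockAveraging.blockAvg (P := F.P K) (j := i) ℰp) k
                (lam42 (Omega 𝔠.lane.carrier.M₁ (rcolOf (T3Scales F γ hγ (hγ1.trans (sq_min_one_le _ 𝔠.gamma0_pos)) K) 𝔠.lane.carrier) k h) k) (sel W) U} ∧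
          IsMinOn (fun U : GaugeField (F.P K) 0 (Matrix.specialUnitaryGroup (Fin 2) ℂ) => wilsonAction4 U)
            (C ∩ {U : GaugeField (F.P K) 0 (Matrix.specialUnitaryGroup (Fin 2) ℂ) |
              ConstraintOn (fun i => BlockAveraging.blockAvg (P := F.P K) (j := i) ℰp) k
                (lam42 (Omega 𝔠.lane.carrier.M₁ (rcolOf (T3Scales F γ hγ (hγ1.trans (sq_min_one_le _ 𝔠.gamma0_pos)) K) 𝔠.lane.carrier) k h) k) (sel W) U}) (f W)) ∧
      (∀ W, (C ∩ {U : GaugeField (F.P K) 0 (Matrix.specialUnitaryGroup (Fin 2) ℂ) |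
              ConstraintOn (fun i => BlockAveraging.blockAvg (P := F.P K) (j := i) ℰp) k
                (lam42 (Omega 𝔠.lane.carrier.M₁ (rcolOf (T3Scales F γ hγ (hγ1.trans (sq_min_one_le _ 𝔠.gamma0_pos)) K) 𝔠.lane.carrier) k h) k) (sel W) U}).Nonempty →
        ∃ U ∈ C ∩ {U : GaugeField (F.P K) 0 (Matrix.specialUnitaryGroup (Fin 2) ℂ) |
              ConstraintOn (fun i => BlockAveraging.blockAvg (P := F.P K) (j := i) ℰp) k
                (lam42 (Omega 𝔠.lane.carrier.M₁ (rcolOf (T3Scales F γ hγ (hγ1.trans (sq_min_one_le _ 𝔠.gamma0_pos)) K) 𝔠.lane.carrier) k h) k) (sel W) U},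
          IsMinOn (fun U : GaugeField (F.P K) 0 (Matrix.specialUnitaryGroup (Fin 2) ℂ) => wilsonAction4 U)
            (C ∩ {U : GaugeField (F.P K) 0 (Matrix.specialUnitaryGroup (Fin 2) ℂ) |
              ConstraintOn (fun i => BlockAveraging.blockAvg (P := F.P K) (j := i) ℰp) k
                (lam42 (Omega 𝔠.lane.carrier.M₁ (rcolOf (T3Scales F γ hγ (hγ1.trans (sq_min_one_le _ 𝔠.gamma0_pos)) K) 𝔠.lane.carrier) k h) k) (sel W) U}) U) := by
  haveI : PolishSpace (Matrix.specialUnitaryGroup (Fin 2) ℂ) := polishSpace_rho (suGroupModel 2)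
  haveI : ∀ j : ℕ, CompactSpace (GaugeField (F.P K) j (Matrix.specialUnitaryGroup (Fin 2) ℂ)) :=
    fun j => inferInstanceAs (CompactSpace (PBond (F.P K) j → Matrix.specialUnitaryGroup (Fin 2) ℂ))
  haveI : ∀ j : ℕ, PolishSpace (GaugeField (F.P K) j (Matrix.specialUnitaryGroup (Fin 2) ℂ)) :=
    fun j => inferInstanceAs (PolishSpace (PBond (F.P K) j → Matrix.specialUnitaryGroup (Fin 2) ℂ))
  haveI : ∀ j : ℕ, SecondCountableTopology (GaugeField (F.P K) j (Matrix.specialUnitaryGroup (Fin 2) ℂ)) :=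
    fun j => inferInstanceAs (SecondCountableTopology (PBond (F.P K) j → Matrix.specialUnitaryGroup (Fin 2) ℂ))
  haveI : ∀ j : ℕ, BorelSpace (GaugeField (F.P K) j (Matrix.specialUnitaryGroup (Fin 2) ℂ)) :=
    fun j => inferInstanceAs (BorelSpace (PBond (F.P K) j → Matrix.specialUnitaryGroup (Fin 2) ℂ))
  haveI : BorelSpace ((j : ℕ) → GaugeField (F.P K) j (Matrix.specialUnitaryGroup (Fin 2) ℂ)) := inferInstance
  -- the letters of the closed-class selection
  set Λ : ℕ → Set (Site (F.P K) 0) :=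
    lam42 (Omega 𝔠.lane.carrier.M₁ (rcolOf (T3Scales F γ hγ (hγ1.trans (sq_min_one_le _ 𝔠.gamma0_pos)) K) 𝔠.lane.carrier) k h) k with hΛ
  let g : GaugeField (F.P K) 0 (Matrix.specialUnitaryGroup (Fin 2) ℂ) → ((j : ℕ) → GaugeField (F.P K) j (Matrix.specialUnitaryGroup (Fin 2) ℂ)) :=
    fun U => datumE (fun i => BlockAveraging.blockAvg (P := F.P K) (j := i) ℰp) k Λ U
  let π : GaugeField (F.P K) k (Matrix.specialUnitaryGroup (Fin 2) ℂ) → ((j : ℕ) → GaugeField (F.P K) j (Matrix.specialUnitaryGroup (Fin 2) ℂ)) :=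
    fun W => ofDataE k Λ (sel W)
  have hπ : Measurable π := (continuous_ofDataE k Λ).measurable.comp hsel
  have hg : ContinuousOn g C :=
    (AlphaInputsT3AC.continuousOn_datumE_T3 (𝔠 := 𝔠) (hγ := hγ) (hγ1 := hγ1) hk h hE hread).mono hCcore
  have hR : IsClosed {p : ((j : ℕ) → GaugeField (F.P K) j (Matrix.specialUnitaryGroup (Fin 2) ℂ)) ×
      ((j : ℕ) → GaugeField (F.P K) j (Matrix.specialUnitaryGroup (Fin 2) ℂ)) | p.1 = p.2} :=
    isClosed_eq continuous_fst continuous_snd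
  -- «`(g U, π W) ∈ R` ↔ (3) at the data `sel W`»
  have hiff : ∀ (U : GaugeField (F.P K) 0 (Matrix.specialUnitaryGroup (Fin 2) ℂ)) (W : GaugeField (F.P K) k (Matrix.specialUnitaryGroup (Fin 2) ℂ)),
      (U ∈ C ∧ (g U, π W) ∈ {p : ((j : ℕ) → GaugeField (F.P K) j (Matrix.specialUnitaryGroup (Fin 2) ℂ)) ×
        ((j : ℕ) → GaugeField (F.P K) j (Matrix.specialUnitaryGroup (Fin 2) ℂ)) | p.1 = p.2}) ↔
      U ∈ C ∩ {U : GaugeField (F.P K) 0 (Matrix.specialUnitaryGroup (Fin 2) ℂ) |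
        ConstraintOn (fun i => BlockAveraging.blockAvg (P := F.P K) (j := i) ℰp) k Λ (sel W) U} := by
    intro U W
    simp only [mem_setOf_eq, mem_inter_iff, g, π]
    rw [datumE_eq_ofDataE_iff]
  have hset : ∀ W : GaugeField (F.P K) k (Matrix.specialUnitaryGroup (Fin 2) ℂ),
      {U : GaugeField (F.P K) 0 (Matrix.specialUnitaryGroup (Fin 2) ℂ) | U ∈ C ∧ (g U, π W) ∈
        {p : ((j : ℕ) → GaugeField (F.P K) j (Matrix.specialUnitaryGroup (Fin 2) ℂ)) ×
          ((j : ℕ) → GaugeField (F.P K) j (Matrix.specialUnitaryGroup (Fin 2) ℂ)) | p.1 = p.2}} =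
      C ∩ {U : GaugeField (F.P K) 0 (Matrix.specialUnitaryGroup (Fin 2) ℂ) |
        ConstraintOn (fun i => BlockAveraging.blockAvg (P := F.P K) (j := i) ℰp) k Λ (sel W) U} :=
    fun W => Set.ext fun U => hiff U W
  obtain ⟨⟨f, hfm, hfin, hfout⟩, hex⟩ := exists_measurable_argmin_closedClass hπ hC hg hR
    (S := fun U : GaugeField (F.P K) 0 (Matrix.specialUnitaryGroup (Fin 2) ℂ) => wilsonAction4 U) AlphaInputsT3AC.continuous_wilsonAction4_su2 1
  refine ⟨f, hfm, fun W hW => ?_, fun W hne => ?_⟩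
  · have h' := hfin W (by rw [hset W]; exact hW)
    rw [hset W] at h'
    exact h'
  · have h' := hex W (by rw [hset W]; exact hne)
    rw [hset W] at h'
    exact h'

end T3

end Summit.QuantumFields.YangMills.Theorems

end
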